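import Summits.Ventures.GridStability.Bench.PLLSWINGDeg4ADuI04K32WideData
import Summits.Ventures.GridStability.Lyapunov.PolyRecastBox
import Mathlib.Tactic.Linarith
import Mathlib.Tactic.Positivity
import HarnessLib

/-!
# G3.d «PLL-swing» deg-4 (wide piece) — REGION-SIZE rider «PLLSWING-DEG4 BALL» (recast half): the ball
# `σ² + κ² + ω² ≤ (171/250)²` on `{h = 0}` lies in the certified sublevel piece `{V₄ ≤ 41}`

Venture GRIDFUSION, cell `gridfusion`; seat gridfusion-lyap-2 (g4), LOW rider (pattern of «#50′ BALL» p537844 / «#62′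
WSCC9-DEG4-BALL» p543377): a kernel INNER description of the certified set of the deg-4 toolchain-A certificate of rung G3.d
«PLL-swing» (`Bench/PLLSWINGDeg4ADuI04K32Wide{Data,}.lean`, sos-5; A file `cert/A/PLLSWING-deg4-A-DuI04-k32-wide.json` sha16
`dbbe752aa0dbf8db`, sos-1 j261767; B twin sos-2 `c2edc4f6a387728e`, ref-1 row 89; -roa companion
`Bench/PLLSWINGDeg4ADuI04K32WideRoa.lean`, lyap-1; model transport `Models/InverterPLLDuI04Roa.lean`, model-3), so that the PLL
basin sentence names a concrete neighbourhood of the locked operating point. Inputs: the degree-4 literal `…_V_poly` (32 monomials)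
and the recast constraint(s) `…_h` of the Data file; the generic box majorant `Lyapunov/PolyRecastBox.lean` (p536818). NOTHING of
the certificate is restated; generator `gen_ball.py pllswing4` (HOME/lean/lyap-2/g4/; `s` found by exact search on the 1/1000 grid,
V_poly parsed from the TREE file).

WHAT IS PROVED (kernel). With `s = 171/250`: on `{h = 0}` (`h_j = κ_j² + σ_j² − 2κ_j`) the ellipsoid `sigma² + kappa² + omega² ≤ s²`
forces `|σ| ≤ s`, `0 ≤ κ ≤ s²/2`, `|ω| ≤ s`, and the coefficient majorant of the quartic `V` on that box is `absBox B V_poly =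
49942820022215925012024069/1220703125000000000000000 ≈ 40.913158 ≤ 41` (ONE `decide`); hence `V ≤ 41 = c` — THE ELLIPSOID LIES IN
THE CERTIFIED PIECE (`…_V_le_level_of_ball`). `s` is the largest multiple of `1/1000` passing the test (at `s + 1/1000` the majorant
is ≈ 41.095034 > c). The ball is the certificate's own gauge ball `φ = σ² + κ² + ω² ≤ s²` (dimensionless PLL frequency variable `ω`
of the generalized swing equation); other aspect ratios give (exact scan in the generator, ω²-coefficient → angle reach / |ω| reach)
1/4 → 25.7°/0.898 (s = 449/1000), 4 → 48.8°/0.426 (s = 851/1000). In the model's coordinates (`σ² + κ² = 2 − 2cos u ≤ u²`): every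
PLL state of the MODEL with `(θ − θ^s)² + ω² ≤ (171/250)²` (phase mismatch ≤ 0.684 rad = 39.2° at `ω = 0`, or `|ω| ≤ 0.684` at the
locked angle) starts inside the certified region (model half: sibling `…RoaBallModel.lean`); the degree / rad·s⁻¹ / percent
renderings of `s` are VALIDATED-column readings of the exact literal, nothing more.

THREE COLUMNS. CERTIFIED (kernel): the inclusion «ellipsoid of gauge radius `171/250` ∩ {h = 0} ⊆ {V ≤ 41}» for the certificate's
`V` — a crude (coefficient-majorant) but exact inner estimate; the true inner radius is larger; an inner set of a CERTIFICATE's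
sublevel piece, never «the ROA of the system». MODELLED: as the parent row (M′ = the PLL generalized swing equation `θ̇ = ω`, `ω̇ =
I − sin θ − (α cos θ − D) ω` [DuEtAl2024, Eq. (1)] at the instance of record «PLLSWING-Du-I04», model-3
`InverterPLL.GenSwing.duI04`; MODEL-VALIDITY MV-6P(GenSwing) + MV-P(I′ = s*): SRF-PLL reduced model, current loops algebraic, PLL
filter / limiters / LVRT logic ABSENT). VALIDATED: only the renderings of `s`. No sentence here says a converter or a grid is
stable; «no loss of lock» = the MODEL's phase mismatch never reaches ±π.
-/

namespace Summit.Ventures.GridStability.Bench.PLLSWING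

open Literature.Computation.Certificates Literature.Computation.Certificates.SOS
open Literature.Computation.Certificates.SOS.Poly
open Summit.Ventures.GridStability.Lyapunov

noncomputable section

/-- The box of the rider: `|σ| ≤ s`, `|κ| ≤ s²/2`, `|ω| ≤ s` with `s = 171/250`, in the certificate's variable order
`(sigma, kappa, omega)`. [folklore] -/
def deg4_A_DuI04_k32_wide_boxB : List ℚ := [171/250, 29241/125000, 171/250]

set_option maxRecDepth 100000 in
/-- **The coefficient majorant of the quartic `V` on the box is below the level**: `absBox B V_poly ≤ 41`
(ONE `decide` over the 32 monomials; exact value `49942820022215925012024069/1220703125000000000000000`). [folklore] -/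
theorem deg4_A_DuI04_k32_wide_absBox_le :
    PolyRecast.absBox (vars deg4_A_DuI04_k32_wide_boxB) deg4_A_DuI04_k32_wide_V_poly ≤ 41 := by
  decide +kernel

/-- **«BALL» (recast coordinates): the ellipsoid lies in the certified piece.** For every point of `{h = 0}` with
`sigma² + kappa² + omega² ≤ (171/250)²`: `V ≤ 41`. [folklore] -/
theorem deg4_A_DuI04_k32_wide_V_le_level_of_ball (sigma kappa omega : ℝ)
    (hh : deg4_A_DuI04_k32_wide_h sigma kappa omega = 0)
    (hball : sigma ^ 2 + kappa ^ 2 + omega ^ 2 ≤ (171 / 250 : ℝ) ^ 2) :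
    deg4_A_DuI04_k32_wide_V sigma kappa omega ≤ 41 := by
  simp only [deg4_A_DuI04_k32_wide_h, deg4_A_DuI04_k32_wide_h_poly, eval_cons, eval_nil, Monomial.eval_eq, Monomial.evalFrom_cons, Monomial.evalFrom_nil,
    vars_cons_zero, vars_cons_succ] at hh
  push_cast at hh
  norm_num at hh
  have hb0 : |sigma| ≤ (171 / 250 : ℝ) := abs_le.2 (abs_le_of_sq_le_sq' (by nlinarith [sq_nonneg sigma, sq_nonneg kappa, sq_nonneg omega]) (by norm_num))
  have hb1 : |kappa| ≤ (29241 / 125000 : ℝ) := abs_le.2 ⟨by nlinarith [hh, sq_nonneg sigma, sq_nonneg kappa, sq_nonneg omega], by nlinarith [hh, hball, sq_nonneg sigma, sq_nonneg kappa, sq_nonneg omega]⟩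
  have hb2 : |omega| ≤ (171 / 250 : ℝ) := abs_le.2 (abs_le_of_sq_le_sq' (by nlinarith [sq_nonneg sigma, sq_nonneg kappa, sq_nonneg omega]) (by norm_num))
  have hB : ∀ i, |vars [sigma, kappa, omega] i| ≤ ((vars deg4_A_DuI04_k32_wide_boxB i : ℚ) : ℝ) := by
    intro i
    match i with
    | 0 => simpa [deg4_A_DuI04_k32_wide_boxB] using hb0
    | 1 => simpa [deg4_A_DuI04_k32_wide_boxB] using hb1
    | 2 => simpa [deg4_A_DuI04_k32_wide_boxB] using hb2
    | n + 3 => simp [deg4_A_DuI04_k32_wide_boxB, vars]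
  have h := PolyRecast.eval_le_absBox hB deg4_A_DuI04_k32_wide_V_poly
  have hc : ((PolyRecast.absBox (vars deg4_A_DuI04_k32_wide_boxB) deg4_A_DuI04_k32_wide_V_poly : ℚ) : ℝ) ≤ ((41 : ℚ) : ℝ) :=
    Rat.cast_le.2 deg4_A_DuI04_k32_wide_absBox_le
  have hc' : ((41 : ℚ) : ℝ) = 41 := by norm_num
  exact h.trans (hc.trans_eq hc')

end

end Summit.Ventures.GridStability.Bench.PLLSWING
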